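import Mathlib
import Summits.MatrixMultiplication.MatrixMultiplication.Theorems.SnSubsetDichotomyPolynomialSlackAtomWins
import Summits.MatrixMultiplication.MatrixMultiplication.Theorems.SnSubsetDichotomyPolynomialSlackAtomBasicFacts
import Summits.MatrixMultiplication.MatrixMultiplication.Theorems.SnSubsetDichotomyPolynomialSlackStubSplit

/-!
# Rate box of the included levels (no-win form)

Crux `Summit.MatrixMultiplication.MatrixMultiplication.Theses.SnSubsetDichotomy.PolynomialSlack`
(item `stmt-MatrixMultiplication-8306`), level-one programme, line transport-split-hull (lead c9),
programme B "atoms endgame", stub `incl_rate_bounds` (HA1b).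

At a fixed hub position `k` of `U`, the heavy column `dB(·,k)` splits into dyadic level blocks
`J_a = {j : θB ≤ dB j k, ⌊log₂(1/dB j k)⌋₊ = a}` with kept masses `σ a`, masses `σ' a` and sizes
`x a = max(|J_a|, 1)`; likewise the heavy row `dC(k,·)` into blocks `I_b` (`ρ b, ρ' b, y b`); the
atom `(a,b)` keeps `Ψ a b`.  Under the standing "no win" hypothesis `W < N = |S||T||U|`, `W`
dominating the three win bounds (depleted flat atom, hub atom of small area, pinned block), the
wrappers of `…PolynomialSlackAtomWins` give, for every atom (`atom_noWin_facts`):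

* substantial levels are unpinned: `ε₁ ≤ σ a ⇒ A₀² n^{-151/100} < (x a)²` (and for `y b`);
* depleted atoms have small area `x a · y b ≤ A₀` and hub mass `< h₁`;
* small hub atoms are strongly anti-depleted: `(n-1)(σρ/n - Ψ) ≤ -(M/2) σ ρ`.

The registered stub `incl_rate_bounds` is the consequence for the included levels (substantial,
with a substantial depleted partner): `0.245 log n ≤ log (x a) ≤ 0.755 log n`, by the scalar
lemma `rate_box` (`u², w² > A₀² n^{-1.51} ≥ n^{0.49}` and `u w ≤ A₀`).
-/

namespace Summit.MatrixMultiplication.MatrixMultiplication.Theorems.PolynomialSlack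

set_option linter.dupNamespace false

open scoped BigOperators
open Literature.Combinatorics.Additive (TripleProductProperty)

/-- **Kept entries on a level block.** On the level block `{θ ≤ d, ⌊log₂(1/d)⌋₊ = a}` of a heavy
profile (`16/n ≤ θ`, `d ≤ 1`), with `β₀ = max((1/2)^{a+1}, θ)`: the cell is heavy, the kept entry
is `p j = d j - 1/n`, the block is flat (`β₀ ≤ d j ≤ 2β₀`) and the kept entries are flat within a
factor `4`: `15/16 β₀ ≤ p j ≤ 4 · (15/16 β₀)`. -/
theorem kept_level_flat {n : ℕ} (hn : 0 < n) (d p : Fin n → ℝ) (θ : ℝ) (hθ : 16 / (n : ℝ) ≤ θ)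
    (hp : ∀ j, p j = if θ ≤ d j then d j - 1 / n else 0) (hd1 : ∀ j, d j ≤ 1) (a : ℕ) (j : Fin n)
    (hj : j ∈ Finset.univ.filter (fun j => θ ≤ d j ∧ ⌊Real.logb 2 (1 / d j)⌋₊ = a)) :
    θ ≤ d j ∧ p j = d j - 1 / n ∧
      (max ((1 / 2 : ℝ) ^ (a + 1)) θ ≤ d j ∧ d j ≤ 2 * max ((1 / 2 : ℝ) ^ (a + 1)) θ) ∧
      (15 / 16 * max ((1 / 2 : ℝ) ^ (a + 1)) θ ≤ p j ∧
        p j ≤ 4 * (15 / 16 * max ((1 / 2 : ℝ) ^ (a + 1)) θ)) := by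
  have hn' : (0 : ℝ) < n := by exact_mod_cast hn
  have hθ0 : 0 < θ := lt_of_lt_of_le (by positivity) hθ
  have hflat := levelBlock_flat d θ hθ0 hd1 a j hj
  have hθj : θ ≤ d j := (Finset.mem_filter.1 hj).2.1
  have hpj : p j = d j - 1 / n := by rw [hp, if_pos hθj]
  have hk := heavy_kept_bounds hn θ (d j) hθ hθj
  have h0 : (0 : ℝ) ≤ 1 / n := by positivity
  have hβθ : θ ≤ max ((1 / 2 : ℝ) ^ (a + 1)) θ := le_max_right _ _
  refine ⟨hθj, hpj, hflat, ?_, ?_⟩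
  · rw [hpj]; linarith [hflat.1, hk.2]
  · rw [hpj]; linarith [hflat.2]

/-- **The rate box (scalar form).** If `2 ≤ n ≤ A₀`, `1 ≤ u, w`, `A₀² n^{-151/100} < u², w²` and
`u w ≤ A₀`, then `0.245 log n ≤ log u ≤ 0.755 log n`: taking logarithms,
`2 log u > 2 log A₀ - 1.51 log n ≥ 0.49 log n` and `2 log u ≤ 2 log A₀ - 2 log w < 1.51 log n`. -/
theorem rate_box {n : ℕ} (hn : 2 ≤ n) {A₀ u w : ℝ} (hA₀n : (n : ℝ) ≤ A₀) (hu1 : 1 ≤ u)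
    (hw1 : 1 ≤ w) (hu : A₀ ^ 2 * (n : ℝ) ^ (-(151 / 100 : ℝ)) < u ^ 2)
    (hw : A₀ ^ 2 * (n : ℝ) ^ (-(151 / 100 : ℝ)) < w ^ 2) (huw : u * w ≤ A₀) :
    245 / 1000 * Real.log n ≤ Real.log u ∧ Real.log u ≤ 755 / 1000 * Real.log n := by
  have hnR : (0 : ℝ) < n := by exact_mod_cast (by omega : 0 < n)
  have hA₀ : 0 < A₀ := hnR.trans_le hA₀n
  have hu0 : 0 < u := one_pos.trans_le hu1
  have hw0 : 0 < w := one_pos.trans_le hw1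
  have hL0 : 0 < A₀ ^ 2 * (n : ℝ) ^ (-(151 / 100 : ℝ)) := by positivity
  have hlogL : Real.log (A₀ ^ 2 * (n : ℝ) ^ (-(151 / 100 : ℝ))) =
      2 * Real.log A₀ + -(151 / 100 : ℝ) * Real.log n := by
    rw [Real.log_mul (pow_pos hA₀ 2).ne' (Real.rpow_pos_of_pos hnR _).ne', Real.log_pow,
      Real.log_rpow hnR]
    push_cast
    ring
  have hlu := Real.log_lt_log hL0 hu
  have hlw := Real.log_lt_log hL0 hw
  rw [hlogL, Real.log_pow] at hlu hlw
  push_cast at hlu hlw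
  have hlA := Real.log_le_log hnR hA₀n
  have hluw : Real.log u + Real.log w ≤ Real.log A₀ := by
    rw [← Real.log_mul hu0.ne' hw0.ne']
    exact Real.log_le_log (mul_pos hu0 hw0) huw
  constructor <;> linarith

/-- **No-win facts of one atom.** At a hub position `k`, for the level blocks `J_a` (of `dB(·,k)`)
and `I_b` (of `dC(k,·)`), under the no-win hypothesis `W < N` (`hW`, `hN`):
(1) `ε₁ ≤ σ a ⇒ A₀² n^{-151/100} < (x a)²` (no pinned-block win for `T`, `card_sq_gt_of_noWin_T`,
and `A₀² n^{-1.51} ≤ P ε₁² ≤ P σ'²`); (2) the same for `y b`; (3) a depleted atom has small area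
`x a · y b ≤ A₀` (`area_max_le_of_depleted`); (4) a depleted atom has hub mass `< h₁` (no
depleted-atom win, `hubMass_lt_of_noWin_depleted`); (5) a small atom of hub mass `≥ h₁` is
strongly anti-depleted, `(n-1)(σρ/n - Ψ) ≤ -(M/2)σρ` (no small-area hub win,
`hits_gt_of_noWin_hubArea`). -/
theorem atom_noWin_facts {n : ℕ} (hn : 2 ≤ n) (B : ℕ)
    (hB : ∀ S' T' U' : Finset (Equiv.Perm (Fin (n - 1))), TripleProductProperty S' T' U' →
      S'.card * T'.card * U'.card ≤ B)
    {S T U : Finset (Equiv.Perm (Fin n))} (hTPP : TripleProductProperty S T U) (hS0 : S.Nonempty)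
    (hT0 : T.Nonempty) (hU0 : U.Nonempty) (dA dB dC pB pC : Fin n → Fin n → ℝ)
    (hdA : ∀ i j, dA i j =
      (((S ×ˢ T).filter fun st => st.2 j = st.1 i).card : ℝ) / (S.card * T.card : ℕ))
    (hdB : ∀ j k, dB j k =
      (((T ×ˢ U).filter fun tu => tu.2 k = tu.1 j).card : ℝ) / (T.card * U.card : ℕ))
    (hdC : ∀ k i, dC k i =
      (((U ×ˢ S).filter fun us => us.2 i = us.1 k).card : ℝ) / (U.card * S.card : ℕ))
    (θB θC : ℝ) (hθB : 16 / (n : ℝ) ≤ θB) (hθC : 16 / (n : ℝ) ≤ θC)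
    (hpB : ∀ j k, pB j k = if θB ≤ dB j k then dB j k - 1 / n else 0)
    (hpC : ∀ k i, pC k i = if θC ≤ dC k i then dC k i - 1 / n else 0)
    (ε₁ ε₂ h₁ M A₀ P W : ℝ) (hε₁ : 0 < ε₁) (hε₂ : 0 < ε₂) (hε₂1 : ε₂ ≤ 1) (hh₁ : 0 < h₁)
    (hP0 : 0 ≤ P)
    (hM : 56 * (((⌊Real.logb 2 ((n : ℝ) ^ 2)⌋₊ + 1 : ℕ) : ℝ) *
      ((⌊Real.logb 2 ((n : ℝ) ^ 2)⌋₊ + 1 : ℕ) : ℝ)) ≤ M)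
    (hA₀ : 5000 * n * (1 + Real.log n) *
      Real.log (4 * ((n.factorial : ℝ) / (S.card * T.card : ℕ)) / ε₂) / ε₂ ^ 2 ≤ A₀)
    (hA₀n : (n : ℝ) ≤ A₀) (hPlow : A₀ ^ 2 * (n : ℝ) ^ (-(151 / 100 : ℝ)) ≤ P * ε₁ ^ 2)
    (hW : 10 ^ 7 * (1 + Real.log n) ^ 2 *
      (Real.log (4 * ((n.factorial : ℝ) / (S.card * T.card : ℕ)) / ε₂)) ^ 2 * n * B /
        (ε₂ ^ 4 * h₁ ^ 2) + 20 * (1 + M) * A₀ ^ 2 * B / (h₁ ^ 2 * n) + n * P * B ≤ W)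
    (hN : W < ((S.card * T.card * U.card : ℕ) : ℝ)) (k : Fin n)
    (σ σ' x ρ ρ' y : Fin (⌊Real.logb 2 ((n : ℝ) ^ 2)⌋₊ + 1) → ℝ)
    (hσ : ∀ a, σ a = ∑ j ∈ Finset.univ.filter
      (fun j => θB ≤ dB j k ∧ ⌊Real.logb 2 (1 / dB j k)⌋₊ = a.val), pB j k)
    (hσ' : ∀ a, σ' a = ∑ j ∈ Finset.univ.filter
      (fun j => θB ≤ dB j k ∧ ⌊Real.logb 2 (1 / dB j k)⌋₊ = a.val), dB j k)
    (hx : ∀ a, x a = max (((Finset.univ.filter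
      (fun j => θB ≤ dB j k ∧ ⌊Real.logb 2 (1 / dB j k)⌋₊ = a.val)).card : ℝ)) 1)
    (hρ : ∀ b, ρ b = ∑ i ∈ Finset.univ.filter
      (fun i => θC ≤ dC k i ∧ ⌊Real.logb 2 (1 / dC k i)⌋₊ = b.val), pC k i)
    (hρ' : ∀ b, ρ' b = ∑ i ∈ Finset.univ.filter
      (fun i => θC ≤ dC k i ∧ ⌊Real.logb 2 (1 / dC k i)⌋₊ = b.val), dC k i)
    (hy : ∀ b, y b = max (((Finset.univ.filter
      (fun i => θC ≤ dC k i ∧ ⌊Real.logb 2 (1 / dC k i)⌋₊ = b.val)).card : ℝ)) 1)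
    (Ψ : Fin (⌊Real.logb 2 ((n : ℝ) ^ 2)⌋₊ + 1) → Fin (⌊Real.logb 2 ((n : ℝ) ^ 2)⌋₊ + 1) → ℝ)
    (hΨ : ∀ a b, Ψ a b = ∑ i ∈ Finset.univ.filter
      (fun i => θC ≤ dC k i ∧ ⌊Real.logb 2 (1 / dC k i)⌋₊ = b.val), ∑ j ∈ Finset.univ.filter
        (fun j => θB ≤ dB j k ∧ ⌊Real.logb 2 (1 / dB j k)⌋₊ = a.val), dA i j * pB j k * pC k i)
    (a b : Fin (⌊Real.logb 2 ((n : ℝ) ^ 2)⌋₊ + 1)) :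
    (ε₁ ≤ σ a → A₀ ^ 2 * (n : ℝ) ^ (-(151 / 100 : ℝ)) < x a ^ 2) ∧
    (ε₁ ≤ ρ b → A₀ ^ 2 * (n : ℝ) ^ (-(151 / 100 : ℝ)) < y b ^ 2) ∧
    (Ψ a b ≤ (1 - ε₂) * (σ a * ρ b) / n → x a * y b ≤ A₀) ∧
    (Ψ a b ≤ (1 - ε₂) * (σ a * ρ b) / n →
      ∑ v : Fin n, ((U.filter fun u => u k = v).card : ℝ) / U.card *
        ((((T.filter fun t => t⁻¹ v ∈ Finset.univ.filter
            (fun j => θB ≤ dB j k ∧ ⌊Real.logb 2 (1 / dB j k)⌋₊ = a.val)).card : ℝ) / T.card) *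
          (((S.filter fun s => s⁻¹ v ∈ Finset.univ.filter
            (fun i => θC ≤ dC k i ∧ ⌊Real.logb 2 (1 / dC k i)⌋₊ = b.val)).card : ℝ) / S.card))
        < h₁) ∧
    (h₁ ≤ ∑ v : Fin n, ((U.filter fun u => u k = v).card : ℝ) / U.card *
        ((((T.filter fun t => t⁻¹ v ∈ Finset.univ.filter
            (fun j => θB ≤ dB j k ∧ ⌊Real.logb 2 (1 / dB j k)⌋₊ = a.val)).card : ℝ) / T.card) *
          (((S.filter fun s => s⁻¹ v ∈ Finset.univ.filter
            (fun i => θC ≤ dC k i ∧ ⌊Real.logb 2 (1 / dC k i)⌋₊ = b.val)).card : ℝ) / S.card)) →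
      x a * y b ≤ A₀ → ((n : ℝ) - 1) * (σ a * ρ b / n - Ψ a b) ≤ -(M / 2) * σ a * ρ b) := by
  have hn0 : 0 < n := by omega
  have hnR : (0 : ℝ) < n := by exact_mod_cast hn0
  have hn2 : (2 : ℝ) ≤ n := by exact_mod_cast hn
  -- the block data at `(a, b)`
  have hσa := hσ a
  have hσ'a := hσ' a
  have hxa := hx a
  have hρb := hρ b
  have hρ'b := hρ' b
  have hyb := hy b
  have hΨab := hΨ a b
  have hσf : 0 ≤ σ a ∧ σ a ≤ σ' a ∧ 15 / 16 * σ' a ≤ σ a := by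
    rw [hσa, hσ'a]
    exact level_sums_cmp hn0 (fun j => dB j k) (fun j => pB j k) θB hθB (fun j => hpB j k) a.val
  have hρf : 0 ≤ ρ b ∧ ρ b ≤ ρ' b ∧ 15 / 16 * ρ' b ≤ ρ b := by
    rw [hρb, hρ'b]
    exact level_sums_cmp hn0 (fun i => dC k i) (fun i => pC k i) θC hθC (fun i => hpC k i) b.val
  set J := Finset.univ.filter (fun j => θB ≤ dB j k ∧ ⌊Real.logb 2 (1 / dB j k)⌋₊ = a.val)
    with hJ
  set I := Finset.univ.filter (fun i => θC ≤ dC k i ∧ ⌊Real.logb 2 (1 / dC k i)⌋₊ = b.val)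
    with hI
  -- flatness of the level blocks
  have hdB1 : ∀ j, dB j k ≤ 1 := fun j => by rw [hdB]; exact pairDensity_le_one T U _
  have hdC1 : ∀ i, dC k i ≤ 1 := fun i => by rw [hdC]; exact pairDensity_le_one U S _
  set β₀ := max ((1 / 2 : ℝ) ^ (a.val + 1)) θB with hβ₀
  set γ₀ := max ((1 / 2 : ℝ) ^ (b.val + 1)) θC with hγ₀
  have hflJ : ∀ j ∈ J, θB ≤ dB j k ∧ pB j k = dB j k - 1 / n ∧ (β₀ ≤ dB j k ∧ dB j k ≤ 2 * β₀) ∧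
      (15 / 16 * β₀ ≤ pB j k ∧ pB j k ≤ 4 * (15 / 16 * β₀)) := fun j hj =>
    kept_level_flat hn0 (fun j => dB j k) (fun j => pB j k) θB hθB (fun j => hpB j k) hdB1 a.val j
      hj
  have hflI : ∀ i ∈ I, θC ≤ dC k i ∧ pC k i = dC k i - 1 / n ∧ (γ₀ ≤ dC k i ∧ dC k i ≤ 2 * γ₀) ∧
      (15 / 16 * γ₀ ≤ pC k i ∧ pC k i ≤ 4 * (15 / 16 * γ₀)) := fun i hi =>
    kept_level_flat hn0 (fun i => dC k i) (fun i => pC k i) θC hθC (fun i => hpC k i) hdC1 b.val i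
      hi
  have hβ : 16 / (n : ℝ) ≤ β₀ := hθB.trans (le_max_right _ _)
  have hγ : 16 / (n : ℝ) ≤ γ₀ := hθC.trans (le_max_right _ _)
  have hβp : 0 < β₀ := lt_of_lt_of_le (by positivity) hβ
  have hγp : 0 < γ₀ := lt_of_lt_of_le (by positivity) hγ
  -- the block sums in the `d - 1/n` form
  have hsumJ : ∑ j ∈ J, (dB j k - 1 / n) = σ a := by
    rw [hσa]
    exact Finset.sum_congr rfl fun j hj => ((hflJ j hj).2.1).symm
  have hsumI : ∑ i ∈ I, (dC k i - 1 / n) = ρ b := by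
    rw [hρb]
    exact Finset.sum_congr rfl fun i hi => ((hflI i hi).2.1).symm
  have hsumΨ : ∑ i ∈ I, ∑ j ∈ J, dA i j * (dB j k - 1 / n) * (dC k i - 1 / n) = Ψ a b := by
    rw [hΨab]
    refine Finset.sum_congr rfl fun i hi => Finset.sum_congr rfl fun j hj => ?_
    rw [(hflJ j hj).2.1, (hflI i hi).2.1]
  -- the three win bounds are nonnegative, hence each is exceeded by `N`
  have hM0 : 0 ≤ M := le_trans (by positivity) hM
  have hW1 : 0 ≤ 10 ^ 7 * (1 + Real.log n) ^ 2 *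
      (Real.log (4 * ((n.factorial : ℝ) / (S.card * T.card : ℕ)) / ε₂)) ^ 2 * n * B /
        (ε₂ ^ 4 * h₁ ^ 2) := by positivity
  have hW2 : 0 ≤ 20 * (1 + M) * A₀ ^ 2 * B / (h₁ ^ 2 * n) := by
    have h1M : 0 ≤ 1 + M := by linarith
    positivity
  have hW3 : 0 ≤ (n : ℝ) * P * B := by positivity
  have hx1 : (J.card : ℝ) ≤ x a := by rw [hxa]; exact le_max_left _ _
  have hy1 : (I.card : ℝ) ≤ y b := by rw [hyb]; exact le_max_left _ _
  refine ⟨fun ha => ?_, fun hb => ?_, fun hdep => ?_, fun hdep => ?_, fun hhub harea => ?_⟩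
  · -- (1) no pinned-block win for `T`
    have hσ'pos : 0 < σ' a := by linarith [hσf.2.1]
    have hmass : σ' a ≤ ∑ v : Fin n, ((U.filter fun u => u k = v).card : ℝ) / U.card *
        (((T.filter fun t => t⁻¹ v ∈ J).card : ℝ) / T.card) := by
      rw [hσ'a, ← blockMass_eq_sum_mu T U hT0 hU0 J k]
      exact le_of_eq (Finset.sum_congr rfl fun j _ => hdB j k)
    have hcard := card_sq_gt_of_noWin_T B hB hTPP hT0 hU0 k J (σ' a) P hσ'pos hP0 hmass
      (lt_of_le_of_lt ((le_add_of_nonneg_left (add_nonneg hW1 hW2)).trans hW) hN)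
    have h1 : P * ε₁ ^ 2 ≤ P * σ' a ^ 2 :=
      mul_le_mul_of_nonneg_left (pow_le_pow_left₀ hε₁.le (by linarith [hσf.2.1]) 2) hP0
    have h2 : (J.card : ℝ) ^ 2 ≤ x a ^ 2 := pow_le_pow_left₀ (Nat.cast_nonneg _) hx1 2
    linarith
  · -- (2) no pinned-block win for `S`
    have hρ'pos : 0 < ρ' b := by linarith [hρf.2.1]
    have hmass : ρ' b ≤ ∑ v : Fin n, ((U.filter fun u => u k = v).card : ℝ) / U.card *
        (((S.filter fun s => s⁻¹ v ∈ I).card : ℝ) / S.card) := by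
      rw [hρ'b, ← blockMassRow_eq_sum_mu U S I k]
      exact le_of_eq (Finset.sum_congr rfl fun i _ => hdC k i)
    have hcard := card_sq_gt_of_noWin_S B hB hTPP hS0 hU0 k I (ρ' b) P hρ'pos hP0 hmass
      (lt_of_le_of_lt ((le_add_of_nonneg_left (add_nonneg hW1 hW2)).trans hW) hN)
    have h1 : P * ε₁ ^ 2 ≤ P * ρ' b ^ 2 :=
      mul_le_mul_of_nonneg_left (pow_le_pow_left₀ hε₁.le (by linarith [hρf.2.1]) 2) hP0
    have h2 : (I.card : ℝ) ^ 2 ≤ y b ^ 2 := pow_le_pow_left₀ (Nat.cast_nonneg _) hy1 2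
    linarith
  · -- (3) depleted atoms have small area
    rw [hxa, hyb]
    have hdep' : ∑ i ∈ I, ∑ j ∈ J, dA i j * pB j k * pC k i ≤
        (1 - ε₂) * ((∑ j ∈ J, pB j k) * (∑ i ∈ I, pC k i)) / n := by
      rw [← hσa, ← hρb, ← hΨab]
      exact hdep
    exact area_max_le_of_depleted hn S T hS0 hT0 (injOn_quot_first hTPP hU0) dA hdA I J
      (fun j => pB j k) (fun i => pC k i) (15 / 16 * β₀) (15 / 16 * γ₀) ε₂ A₀ (by positivity)
      (by positivity) hε₂ hε₂1 (fun j hj => (hflJ j hj).2.2.2) (fun i hi => (hflI i hi).2.2.2)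
      hdep' hA₀ hA₀n
  · -- (4) no depleted-atom win
    have hdep' : ∑ i ∈ I, ∑ j ∈ J, dA i j * (dB j k - 1 / n) * (dC k i - 1 / n) ≤
        (1 - ε₂) * ((∑ j ∈ J, (dB j k - 1 / n)) * (∑ i ∈ I, (dC k i - 1 / n))) / n := by
      rw [hsumJ, hsumI, hsumΨ]
      exact hdep
    exact hubMass_lt_of_noWin_depleted hn B hB hTPP hS0 hT0 hU0 dA dB dC hdA hdB hdC k J I β₀ γ₀
      ε₂ h₁ hβ hγ hε₂ hε₂1 hh₁ (fun j hj => (hflJ j hj).2.2.1) (fun i hi => (hflI i hi).2.2.1)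
      hdep' (lt_of_le_of_lt
        (((le_add_of_nonneg_right hW2).trans (le_add_of_nonneg_right hW3)).trans hW) hN)
  · -- (5) no small-area hub win
    have harea' : (I.card : ℝ) * J.card ≤ A₀ :=
      calc (I.card : ℝ) * J.card ≤ y b * x a :=
            mul_le_mul hy1 hx1 (Nat.cast_nonneg _) ((Nat.cast_nonneg _).trans hy1)
        _ = x a * y b := mul_comm _ _
        _ ≤ A₀ := harea
    have hhit := hits_gt_of_noWin_hubArea hn B hB hTPP hS0 hT0 hU0 dA dB dC hdA hdB hdC k J I β₀
      γ₀ M h₁ A₀ hβ hγ hM0 hh₁ (fun j hj => (hflJ j hj).2.2.1) (fun i hi => (hflI i hi).2.2.1)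
      hhub harea' (lt_of_le_of_lt
        (((le_add_of_nonneg_left hW1).trans (le_add_of_nonneg_right hW3)).trans hW) hN)
    rw [hsumJ, hsumI, hsumΨ] at hhit
    have hsr : 0 ≤ σ a * ρ b := mul_nonneg hσf.1 hρf.1
    have hq : (1 + M) * (σ a * ρ b) / n = σ a * ρ b / n + M * (σ a * ρ b) / n := by ring
    have hn1 : (0 : ℝ) ≤ (n : ℝ) - 1 := by linarith
    have h2 : ((n : ℝ) - 1) * (σ a * ρ b / n - Ψ a b) ≤
        ((n : ℝ) - 1) * (-(M * (σ a * ρ b) / n)) :=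
      mul_le_mul_of_nonneg_left (by linarith) hn1
    have h3 : (1 / 2 : ℝ) ≤ ((n : ℝ) - 1) / n := by
      rw [le_div_iff₀ hnR]
      linarith
    have h4 : M * (σ a * ρ b) * (1 / 2) ≤ M * (σ a * ρ b) * (((n : ℝ) - 1) / n) :=
      mul_le_mul_of_nonneg_left h3 (mul_nonneg hM0 hsr)
    have h5 : ((n : ℝ) - 1) * (-(M * (σ a * ρ b) / n)) =
        -(M * (σ a * ρ b) * (((n : ℝ) - 1) / n)) := by ring
    have h6 : -(M / 2) * σ a * ρ b = -(M * (σ a * ρ b) * (1 / 2)) := by ring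
    rw [h6]
    linarith

/-- **Rate box of the included levels (HA1b, no-win form).** At a hub position `k`, under the
no-win hypothesis `W < N`: every substantial T-level `a` (`ε₁ ≤ σ a`) with a substantial depleted
partner `b` (`ε₁ ≤ ρ b`, `Ψ a b ≤ (1-ε₂) σ a ρ b / n`) has block size
`0.245 log n ≤ log (x a) ≤ 0.755 log n`, and symmetrically for the S-levels.  Proof: both blocks
are unpinned (`x a², y b² > A₀² n^{-1.51}`, `atom_noWin_facts` (1)-(2)) and the depleted atom has
area `x a · y b ≤ A₀` ((3)); conclude by `rate_box`. -/
theorem incl_rate_bounds {n : ℕ} (hn : 2 ≤ n) (B : ℕ) (hB : ∀ S' T' U' : Finset (Equiv.Perm (Fin (n - 1))), TripleProductProperty S' T' U' → S'.card * T'.card * U'.card ≤ B) {S T U : Finset (Equiv.Perm (Fin n))} (hTPP : TripleProductProperty S T U) (hS0 : S.Nonempty) (hT0 : T.Nonempty) (hU0 : U.Nonempty) (dA dB dC pB pC : Fin n → Fin n → ℝ) (hdA : ∀ i j, dA i j = (((S ×ˢ T).filter fun st => st.2 j = st.1 i).card : ℝ) / (S.card * T.card : ℕ)) (hdB : ∀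 j k, dB j k = (((T ×ˢ U).filter fun tu => tu.2 k = tu.1 j).card : ℝ) / (T.card * U.card : ℕ)) (hdC : ∀ k i, dC k i = (((U ×ˢ S).filter fun us => us.2 i = us.1 k).card : ℝ) / (U.card * S.card : ℕ)) (θB θC : ℝ) (hθB : 16 / (n : ℝ) ≤ θB) (hθC : 16 / (n : ℝ) ≤ θC) (hpB : ∀ j k, pB j k = if θB ≤ dB j k then dB j k - 1 / n else 0) (hpC : ∀ k i, pC k i = if θC ≤ dC k i then dC k i - 1 / n else 0) (ε₁ ε₂ h₁ M A₀ P W : ℝ) (hε₁ : 0 < ε₁) (hε₂ : 0 < ε₂) (hε₂1 : ε₂ ≤ 1) (hh₁ : 0 < h₁) (hP0 : 0 ≤ P) (hM : 56 * (((⌊Real.logb 2 ((n : ℝ) ^ 2)⌋₊ + 1 : ℕ) : ℝ) * ((⌊Real.logb 2 ((n : ℝ) ^ 2)⌋₊ + 1 : ℕ) : ℝ)) ≤ M) (hA₀ : 5000 * n * (1 + Real.log n) * Real.log (4 * ((n.factorial : ℝ) / (S.card * T.card : ℕ)) / ε₂) / ε₂ ^ 2 ≤ A₀) (hA₀n : (n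 : ℝ) ≤ A₀) (hA₀log : Real.log A₀ ≤ 101 / 100 * Real.log n) (hPlow : A₀ ^ 2 * (n : ℝ) ^ (-(151 / 100 : ℝ)) ≤ P * ε₁ ^ 2) (hW : 10 ^ 7 * (1 + Real.log n) ^ 2 * (Real.log (4 * ((n.factorial : ℝ) / (S.card * T.card : ℕ)) / ε₂)) ^ 2 * n * B / (ε₂ ^ 4 * h₁ ^ 2) + 20 * (1 + M) * A₀ ^ 2 * B / (h₁ ^ 2 * n) + n * P * B ≤ W) (hN : W < ((S.card * T.card * U.card : ℕ) : ℝ)) (k : Fin n) (σ σ' x ρ ρ' y : Fin (⌊Real.logb 2 ((n : ℝ) ^ 2)⌋₊ + 1) → ℝ) (hσ : ∀ a, σ a = ∑ j ∈ Finset.univ.filter (fun j => θB ≤ dB j k ∧ ⌊Real.logb 2 (1 / dB j k)⌋₊ = a.val), pB j k) (hσ' : ∀ a, σ' a = ∑ j ∈ Finset.univ.filter (fun j => θB ≤ dB j k ∧ ⌊Real.logb 2 (1 / dB j k)⌋₊ = a.val), dB j k) (hx : ∀ a, x a = max (((Finset.univ.filter (fun j => θB ≤ dB j k ∧ ⌊Real.logb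 2 (1 / dB j k)⌋₊ = a.val)).card : ℝ)) 1) (hρ : ∀ b, ρ b = ∑ i ∈ Finset.univ.filter (fun i => θC ≤ dC k i ∧ ⌊Real.logb 2 (1 / dC k i)⌋₊ = b.val), pC k i) (hρ' : ∀ b, ρ' b = ∑ i ∈ Finset.univ.filter (fun i => θC ≤ dC k i ∧ ⌊Real.logb 2 (1 / dC k i)⌋₊ = b.val), dC k i) (hy : ∀ b, y b = max (((Finset.univ.filter (fun i => θC ≤ dC k i ∧ ⌊Real.logb 2 (1 / dC k i)⌋₊ = b.val)).card : ℝ)) 1) (Ψ : Fin (⌊Real.logb 2 ((n : ℝ) ^ 2)⌋₊ + 1) → Fin (⌊Real.logb 2 ((n : ℝ) ^ 2)⌋₊ + 1) → ℝ) (hΨ : ∀ a b, Ψ a b = ∑ i ∈ Finset.univ.filter (fun i => θC ≤ dC k i ∧ ⌊Real.logb 2 (1 / dC k i)⌋₊ = b.val), ∑ j ∈ Finset.univ.filter (fun j => θB ≤ dB j k ∧ ⌊Real.logb 2 (1 / dB j k)⌋₊ = a.val), dA i j * pB j k * pC k i) : (∀ a, (ε₁ ≤ σ a ∧ ∃ b,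 ε₁ ≤ ρ b ∧ Ψ a b ≤ (1 - ε₂) * (σ a * ρ b) / n) → 245 / 1000 * Real.log n ≤ Real.log (x a) ∧ Real.log (x a) ≤ 755 / 1000 * Real.log n) ∧ (∀ b, (ε₁ ≤ ρ b ∧ ∃ a, ε₁ ≤ σ a ∧ Ψ a b ≤ (1 - ε₂) * (σ a * ρ b) / n) → 245 / 1000 * Real.log n ≤ Real.log (y b) ∧ Real.log (y b) ≤ 755 / 1000 * Real.log n) := by
  have _h := hA₀log
  have hAF := fun a b => atom_noWin_facts hn B hB hTPP hS0 hT0 hU0 dA dB dC pB pC hdA hdB hdC θB θC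
    hθB hθC hpB hpC ε₁ ε₂ h₁ M A₀ P W hε₁ hε₂ hε₂1 hh₁ hP0 hM hA₀ hA₀n hPlow hW hN k σ σ' x ρ ρ' y
    hσ hσ' hx hρ hρ' hy Ψ hΨ a b
  have hx1 : ∀ a, 1 ≤ x a := fun a => by rw [hx]; exact le_max_right _ _
  have hy1 : ∀ b, 1 ≤ y b := fun b => by rw [hy]; exact le_max_right _ _
  refine ⟨fun a ⟨ha, b, hb, hdep⟩ => ?_, fun b ⟨hb, a, ha, hdep⟩ => ?_⟩
  · obtain ⟨h1, h2, h3, -, -⟩ := hAF a b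
    exact rate_box hn hA₀n (hx1 a) (hy1 b) (h1 ha) (h2 hb) (h3 hdep)
  · obtain ⟨h1, h2, h3, -, -⟩ := hAF a b
    exact rate_box hn hA₀n (hy1 b) (hx1 a) (h2 hb) (h1 ha) ((mul_comm _ _).trans_le (h3 hdep))

end Summit.MatrixMultiplication.MatrixMultiplication.Theorems.PolynomialSlack
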